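import Literature.NumberTheory.LFunctions.MoebiusHarmonicSumBound
import HarnessLib

/-!
# The truncated Dirichlet series of `μ` to the right of `1`: `Σ_{n ≤ y} μ(n) n^{-s} = 1/ζ(s) + O(e^{-c√log y})` uniformly in `s > 1`

Topic `Literature/NumberTheory/LFunctions` (trunk T-ANT). Everything in this file is PROVED.
From the tree's `|Σ_{n ≤ x} μ(n)/n| ≤ C e^{-c√log x}`
(`Literature.NumberTheory.LFunctions.abs_sum_moebius_div_le_exp_neg_sqrt_log`,
`MoebiusHarmonicSumBound.lean`) by partial summation with the weight `u^{1-s}`: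

* `Literature.NumberTheory.LFunctions.abs_sum_Ioc_moebius_div_rpow_le` — for real `s ≥ 1` and
  `2 ≤ y ≤ Y`, `|Σ_{y < n ≤ Y} μ(n) n^{-s}| ≤ 3C e^{-c√log y}` (the constants are those of the input
  bound, uniform in `s`);
* `Literature.NumberTheory.LFunctions.norm_sum_moebius_div_rpow_sub_inv_zeta_le` — hence, for
  real `s > 1` and `y ≥ 2`, `|Σ_{n ≤ y} μ(n) n^{-s} − 1/ζ(s)| ≤ 3C e^{-c√log y}`, letting `Y → ∞`
  in the previous bound (`L(μ, s) = 1/ζ(s)`, Mathlib `LSeries_one_mul_Lseries_moebius`).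

The uniformity in `s` is the point: with `s = 1 + 2δ`, `δ = a/log T → 0`, this is the input for the
evaluation of the Selberg/Levinson mollifier quadratic form
`Σ_{h,k ≤ X} b_h b_k [h,k]^{-s}` (programme recorded in `SelbergFujiiSmallGaps.lean`; first step in
`Literature/NumberTheory/Sieve/GcdQuadraticForm.lean`).

## References

* H. L. Montgomery, R. C. Vaughan, *Multiplicative Number Theory I*, CUP 2007, §6.2 (Thm 6.9 and
  exercises) and §8.1. [key `MontgomeryVaughan2007`]
-/

noncomputable section

open Real MeasureTheory Set Filter Topology Finset
open scoped ArithmeticFunction.Moebius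

namespace Literature.NumberTheory.LFunctions

/-- **Tails of `Σ μ(n) n^{-s}` by partial summation.** Let `c > 0`, `C` be such that
`|Σ_{n ≤ x} μ(n)/n| ≤ C e^{-c√log x}` for all `x ≥ 2`. Then for real `s ≥ 1` and `2 ≤ y ≤ Y`,
`|Σ_{y < n ≤ Y} μ(n) n^{-s}| ≤ 3C e^{-c√log y}`: Abel summation of `μ(n)/n` against
`f(u) = u^{1-s}` gives `f(Y)m(Y) − f(y)m(y) + (s−1)∫_y^Y m(u) u^{-s} du` with
`|m(u)| ≤ C e^{-c√log u} ≤ C e^{-c√log y}`, `0 ≤ f ≤ 1` and `(s−1)∫_y^Y u^{-s} du ≤ y^{1-s} ≤ 1`.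
[cite: MontgomeryVaughan2007, §6.2] -/
theorem abs_sum_Ioc_moebius_div_rpow_le {c C : ℝ} (hc : 0 < c)
    (hM : ∀ x : ℝ, 2 ≤ x → |∑ k ∈ Finset.Icc 1 ⌊x⌋₊, (μ k : ℝ) / k| ≤
      C * Real.exp (-c * Real.sqrt (Real.log x)))
    {s : ℝ} (hs : 1 ≤ s) {y Y : ℝ} (hy : 2 ≤ y) (hyY : y ≤ Y) :
    |∑ k ∈ Finset.Ioc ⌊y⌋₊ ⌊Y⌋₊, (μ k : ℝ) / (k : ℝ) ^ s| ≤
      3 * C * Real.exp (-c * Real.sqrt (Real.log y)) := by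
  have hC : 0 ≤ C := by
    have h := hM 2 le_rfl
    have := (abs_nonneg _).trans h
    exact nonneg_of_mul_nonneg_left (by simpa using this) (Real.exp_pos _)
  have hy0 : (0 : ℝ) ≤ y := by linarith
  have hy1 : (1 : ℝ) < y := by linarith
  set ε : ℝ := C * Real.exp (-c * Real.sqrt (Real.log y)) with hε
  have hε0 : 0 ≤ ε := by positivity
  -- the partial sums `m(u) = Σ_{n ≤ u} μ(n)/n` and their bound on `[y, ∞)`
  set cμ : ℕ → ℝ := fun k ↦ (μ k : ℝ) / k with hcμ
  have hm_eq : ∀ u : ℝ, ∑ k ∈ Finset.Icc 0 ⌊u⌋₊, cμ k = ∑ k ∈ Finset.Icc 1 ⌊u⌋₊, (μ k : ℝ) / k := by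
    intro u
    rw [← Finset.sum_Ioc_add_eq_sum_Icc (Nat.zero_le _), ← Finset.Icc_add_one_left_eq_Ioc]
    simp [hcμ]
  have hm : ∀ u : ℝ, y ≤ u → |∑ k ∈ Finset.Icc 0 ⌊u⌋₊, cμ k| ≤ ε := by
    intro u hu
    rw [hm_eq]
    refine (hM u (hy.trans hu)).trans ?_
    rw [hε]
    refine mul_le_mul_of_nonneg_left (Real.exp_le_exp.2 ?_) hC
    have := Real.sqrt_le_sqrt (Real.log_le_log (by linarith) hu)
    nlinarith
  -- the weight `f(u) = u^{1-s}` and its derivative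
  set f : ℝ → ℝ := fun u ↦ u ^ (1 - s) with hf
  set g : ℝ → ℝ := fun u ↦ (1 - s) * u ^ (1 - s - 1) with hg
  have hderiv : ∀ u : ℝ, 0 < u → HasDerivAt f (g u) u := fun u hu ↦
    Real.hasDerivAt_rpow_const (Or.inl hu.ne')
  have hfI : ∀ u ∈ Set.Icc y Y, 0 < u := fun u hu ↦ by linarith [hu.1]
  have hf_diff : ∀ u ∈ Set.Icc y Y, DifferentiableAt ℝ f u := fun u hu ↦
    (hderiv u (hfI u hu)).differentiableAt
  have hgcont : ContinuousOn g (Set.Icc y Y) := by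
    refine continuousOn_const.mul (ContinuousOn.rpow_const continuousOn_id fun u hu ↦ ?_)
    exact Or.inl (hfI u hu).ne'
  have hderiv_eq : Set.EqOn g (deriv f) (Set.Icc y Y) := fun u hu ↦ ((hderiv u (hfI u hu)).deriv).symm
  have hg_int : IntegrableOn g (Set.Icc y Y) := hgcont.integrableOn_Icc
  have hf_int : IntegrableOn (deriv f) (Set.Icc y Y) := hg_int.congr_fun hderiv_eq measurableSet_Icc
  have habel := sum_mul_eq_sub_sub_integral_mul cμ hy0 hyY hf_diff hf_int
  -- the left-hand side
  have hlhs : ∑ k ∈ Finset.Ioc ⌊y⌋₊ ⌊Y⌋₊, f k * cμ k =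
      ∑ k ∈ Finset.Ioc ⌊y⌋₊ ⌊Y⌋₊, (μ k : ℝ) / (k : ℝ) ^ s := by
    refine Finset.sum_congr rfl fun k hk ↦ ?_
    have hk1 : 1 ≤ k := by
      have := (Finset.mem_Ioc.1 hk).1
      have : 1 ≤ ⌊y⌋₊ := Nat.le_floor (by norm_num; linarith)
      omega
    have hk0 : (0 : ℝ) < k := by exact_mod_cast hk1
    simp only [hf, hcμ]
    rw [Real.rpow_sub hk0, Real.rpow_one]
    field_simp
  -- bounds: `0 ≤ f ≤ 1` on `[y, ∞)`
  have hf01 : ∀ u : ℝ, y ≤ u → 0 ≤ f u ∧ f u ≤ 1 := by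
    intro u hu
    have hu1 : 1 ≤ u := by linarith
    refine ⟨Real.rpow_nonneg (by linarith) _, ?_⟩
    exact Real.rpow_le_one_of_one_le_of_nonpos hu1 (by linarith)
  have hb1 : |f Y * ∑ k ∈ Finset.Icc 0 ⌊Y⌋₊, cμ k| ≤ ε := by
    rw [abs_mul, abs_of_nonneg (hf01 Y hyY).1]
    calc f Y * |∑ k ∈ Finset.Icc 0 ⌊Y⌋₊, cμ k| ≤ 1 * ε :=
          mul_le_mul (hf01 Y hyY).2 (hm Y hyY) (abs_nonneg _) zero_le_one
      _ = ε := one_mul ε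
  have hb2 : |f y * ∑ k ∈ Finset.Icc 0 ⌊y⌋₊, cμ k| ≤ ε := by
    rw [abs_mul, abs_of_nonneg (hf01 y le_rfl).1]
    calc f y * |∑ k ∈ Finset.Icc 0 ⌊y⌋₊, cμ k| ≤ 1 * ε :=
          mul_le_mul (hf01 y le_rfl).2 (hm y le_rfl) (abs_nonneg _) zero_le_one
      _ = ε := one_mul ε
  -- the integral: `|∫ g m| ≤ ε (s-1) ∫_y^Y u^{-s} du ≤ ε`
  have hb3 : |∫ u in Set.Ioc y Y, deriv f u * ∑ k ∈ Finset.Icc 0 ⌊u⌋₊, cμ k| ≤ ε := by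
    have h1 : ∫ u in Set.Ioc y Y, deriv f u * ∑ k ∈ Finset.Icc 0 ⌊u⌋₊, cμ k =
        ∫ u in Set.Ioc y Y, g u * ∑ k ∈ Finset.Icc 0 ⌊u⌋₊, cμ k := by
      refine setIntegral_congr_fun measurableSet_Ioc fun u hu ↦ ?_
      rw [hderiv_eq (Set.Ioc_subset_Icc_self hu)]
    rw [h1]
    set w : ℝ → ℝ := fun u ↦ (s - 1) * u ^ (-s) with hw
    have hwcont : ContinuousOn w (Set.Icc y Y) := by
      refine continuousOn_const.mul (ContinuousOn.rpow_const continuousOn_id fun u hu ↦ ?_)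
      exact Or.inl (hfI u hu).ne'
    have hbound : ∀ u ∈ Set.Ioc y Y, |g u * ∑ k ∈ Finset.Icc 0 ⌊u⌋₊, cμ k| ≤ ε * w u := by
      intro u hu
      have hu0 : 0 < u := hfI u (Set.Ioc_subset_Icc_self hu)
      rw [abs_mul, mul_comm ε]
      refine mul_le_mul ?_ (hm u hu.1.le) (abs_nonneg _) ?_
      · simp only [hg, hw]
        rw [abs_mul, show (1 - s - 1 : ℝ) = -s by ring, abs_of_nonneg (Real.rpow_nonneg hu0.le _),
          abs_of_nonpos (by linarith : (1 - s : ℝ) ≤ 0), neg_sub]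
      · simp only [hw]; exact mul_nonneg (by linarith) (Real.rpow_nonneg hu0.le _)
    have hgm_int : IntegrableOn (fun u ↦ g u * ∑ k ∈ Finset.Icc 0 ⌊u⌋₊, cμ k) (Set.Ioc y Y) :=
      (integrableOn_mul_sum_Icc cμ hy0 hg_int).mono_set Set.Ioc_subset_Icc_self
    have hw_int : IntegrableOn (fun u ↦ ε * w u) (Set.Ioc y Y) :=
      ((hwcont.integrableOn_Icc).mono_set Set.Ioc_subset_Icc_self).const_mul ε
    have h2 : |∫ u in Set.Ioc y Y, g u * ∑ k ∈ Finset.Icc 0 ⌊u⌋₊, cμ k| ≤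
        ∫ u in Set.Ioc y Y, ε * w u := by
      refine (abs_integral_le_integral_abs).trans ?_
      exact setIntegral_mono_on hgm_int.abs hw_int measurableSet_Ioc hbound
    -- `∫_y^Y (s-1) u^{-s} du = y^{1-s} - Y^{1-s} ≤ 1`
    have hW : ∫ u in Set.Ioc y Y, w u = y ^ (1 - s) - Y ^ (1 - s) := by
      rw [← intervalIntegral.integral_of_le hyY]
      have hanti : ∀ u ∈ Set.uIcc y Y, HasDerivAt (fun u ↦ -(u ^ (1 - s))) (w u) u := by
        intro u hu
        rw [Set.uIcc_of_le hyY] at hu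
        have hu0 : 0 < u := hfI u hu
        have := (hderiv u hu0).neg
        refine this.congr_deriv ?_
        simp only [hg, hw, show (1 - s - 1 : ℝ) = -s by ring]; ring
      rw [intervalIntegral.integral_eq_sub_of_hasDerivAt hanti
        ((hwcont.mono (by rw [Set.uIcc_of_le hyY])).intervalIntegrable)]
      ring
    rw [integral_const_mul, hW] at h2
    have hy1s : y ^ (1 - s) ≤ 1 := (hf01 y le_rfl).2
    have hY0 : 0 ≤ Y ^ (1 - s) := (hf01 Y hyY).1
    calc |∫ u in Set.Ioc y Y, g u * ∑ k ∈ Finset.Icc 0 ⌊u⌋₊, cμ k| ≤ ε * (y ^ (1 - s) - Y ^ (1 - s)) := h2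
      _ ≤ ε * 1 := mul_le_mul_of_nonneg_left (by linarith) hε0
      _ = ε := mul_one ε
  -- assemble
  rw [← hlhs, habel]
  have := abs_sub_le (f Y * ∑ k ∈ Finset.Icc 0 ⌊Y⌋₊, cμ k - f y * ∑ k ∈ Finset.Icc 0 ⌊y⌋₊, cμ k) 0
    (∫ u in Set.Ioc y Y, deriv f u * ∑ k ∈ Finset.Icc 0 ⌊u⌋₊, cμ k)
  have h4 := abs_sub (f Y * ∑ k ∈ Finset.Icc 0 ⌊Y⌋₊, cμ k) (f y * ∑ k ∈ Finset.Icc 0 ⌊y⌋₊, cμ k)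
  rw [sub_zero] at this
  rw [zero_sub, abs_neg] at this
  calc |f Y * ∑ k ∈ Finset.Icc 0 ⌊Y⌋₊, cμ k - f y * ∑ k ∈ Finset.Icc 0 ⌊y⌋₊, cμ k -
        ∫ u in Set.Ioc y Y, deriv f u * ∑ k ∈ Finset.Icc 0 ⌊u⌋₊, cμ k|
      ≤ ε + ε + ε := by linarith
    _ = 3 * C * Real.exp (-c * Real.sqrt (Real.log y)) := by rw [hε]; ring

/-- The complex `L`-series partial sums of `μ` at a real `s` are the real partial sums. [folklore] -/
theorem sum_range_term_moebius_eq (s : ℝ) (N : ℕ) :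
    ∑ n ∈ Finset.range (N + 1), LSeries.term (fun n ↦ (μ n : ℂ)) (s : ℂ) n =
      ((∑ k ∈ Finset.Icc 1 N, (μ k : ℝ) / (k : ℝ) ^ s : ℝ) : ℂ) := by
  rw [Nat.range_succ_eq_Icc_zero, ← Finset.sum_Ioc_add_eq_sum_Icc (Nat.zero_le N),
    LSeries.term_zero, add_zero, ← Finset.Icc_add_one_left_eq_Ioc, Complex.ofReal_sum]
  refine Finset.sum_congr rfl fun k hk ↦ ?_
  have hk : k ≠ 0 := by have := (Finset.mem_Icc.1 hk).1; omega
  rw [LSeries.term_of_ne_zero hk, Complex.ofReal_div, Complex.ofReal_cpow (Nat.cast_nonneg k)]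
  simp

/-- **`Σ_{n ≤ y} μ(n) n^{-s} = 1/ζ(s) + O(e^{-c√log y})`, uniformly in real `s > 1`.** With the
constants `c, C` of `abs_sum_moebius_div_le_exp_neg_sqrt_log`: for real `s > 1` and `y ≥ 2`,
`‖Σ_{n ≤ y} μ(n) n^{-s} − ζ(s)⁻¹‖ ≤ 3C e^{-c√log y}`. (Let `Y → ∞` in
`abs_sum_Ioc_moebius_div_rpow_le`, using `L(μ,s) = ζ(s)⁻¹`.) [cite: MontgomeryVaughan2007, §6.2] -/
theorem norm_sum_moebius_div_rpow_sub_inv_zeta_le {c C : ℝ} (hc : 0 < c)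
    (hM : ∀ x : ℝ, 2 ≤ x → |∑ k ∈ Finset.Icc 1 ⌊x⌋₊, (μ k : ℝ) / k| ≤
      C * Real.exp (-c * Real.sqrt (Real.log x)))
    {s : ℝ} (hs : 1 < s) {y : ℝ} (hy : 2 ≤ y) :
    ‖((∑ k ∈ Finset.Icc 1 ⌊y⌋₊, (μ k : ℝ) / (k : ℝ) ^ s : ℝ) : ℂ) - (riemannZeta (s : ℂ))⁻¹‖ ≤
      3 * C * Real.exp (-c * Real.sqrt (Real.log y)) := by
  have hsre : 1 < (s : ℂ).re := by simpa using hs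
  -- `L(μ, s) = ζ(s)⁻¹` and the partial sums converge to it
  have hL : LSeries (fun n ↦ (μ n : ℂ)) (s : ℂ) = (riemannZeta (s : ℂ))⁻¹ := by
    have h := LSeries_one_mul_Lseries_moebius hsre
    rw [LSeries_one_eq_riemannZeta hsre] at h
    exact eq_inv_of_mul_eq_one_right h
  have hsum : LSeriesHasSum (fun n ↦ (μ n : ℂ)) (s : ℂ) (riemannZeta (s : ℂ))⁻¹ :=
    hL ▸ (ArithmeticFunction.LSeriesSummable_moebius_iff.2 hsre).LSeriesHasSum
  have htend : Tendsto (fun N : ℕ ↦ ((∑ k ∈ Finset.Icc 1 N, (μ k : ℝ) / (k : ℝ) ^ s : ℝ) : ℂ))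
      atTop (𝓝 (riemannZeta (s : ℂ))⁻¹) := by
    have h1 := hsum.tendsto_sum_nat
    have h2 : Tendsto (fun N : ℕ ↦ ∑ n ∈ Finset.range (N + 1),
        LSeries.term (fun n ↦ (μ n : ℂ)) (s : ℂ) n) atTop (𝓝 (riemannZeta (s : ℂ))⁻¹) :=
      h1.comp (tendsto_add_atTop_nat 1)
    refine h2.congr fun N ↦ ?_
    exact sum_range_term_moebius_eq s N
  -- uniform bound for the difference of partial sums beyond `y`
  have hdiff : ∀ N : ℕ, y ≤ N →
      ‖((∑ k ∈ Finset.Icc 1 ⌊y⌋₊, (μ k : ℝ) / (k : ℝ) ^ s : ℝ) : ℂ) -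
        ((∑ k ∈ Finset.Icc 1 N, (μ k : ℝ) / (k : ℝ) ^ s : ℝ) : ℂ)‖ ≤
      3 * C * Real.exp (-c * Real.sqrt (Real.log y)) := by
    intro N hN
    have h := abs_sum_Ioc_moebius_div_rpow_le hc hM hs.le hy hN
    rw [Nat.floor_natCast] at h
    have hle : ⌊y⌋₊ ≤ N := Nat.floor_le_of_le (by exact_mod_cast hN)
    have hsplit : ∑ k ∈ Finset.Icc 1 N, (μ k : ℝ) / (k : ℝ) ^ s =
        (∑ k ∈ Finset.Icc 1 ⌊y⌋₊, (μ k : ℝ) / (k : ℝ) ^ s) +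
          ∑ k ∈ Finset.Ioc ⌊y⌋₊ N, (μ k : ℝ) / (k : ℝ) ^ s := by
      rw [← Finset.sum_union]
      · congr 1
        ext k; simp [Finset.mem_Icc, Finset.mem_Ioc]; omega
      · rw [Finset.disjoint_left]
        intro k hk hk'
        simp [Finset.mem_Icc, Finset.mem_Ioc] at hk hk'
        omega
    rw [← Complex.ofReal_sub, Complex.norm_real, Real.norm_eq_abs, hsplit,
      show ∀ a b : ℝ, a - (a + b) = -b by intros; ring, abs_neg]
    exact h
  -- pass to the limit
  have hev : ∀ᶠ N : ℕ in atTop,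
      ‖((∑ k ∈ Finset.Icc 1 ⌊y⌋₊, (μ k : ℝ) / (k : ℝ) ^ s : ℝ) : ℂ) -
        ((∑ k ∈ Finset.Icc 1 N, (μ k : ℝ) / (k : ℝ) ^ s : ℝ) : ℂ)‖ ≤
      3 * C * Real.exp (-c * Real.sqrt (Real.log y)) := by
    filter_upwards [eventually_ge_atTop ⌈y⌉₊] with N hN
    exact hdiff N ((Nat.le_ceil y).trans (by exact_mod_cast hN))
  exact le_of_tendsto ((tendsto_const_nhds.sub htend).norm) hev

/-- The same with the constants packaged: there are absolute `c > 0`, `C` such that for all real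
`s > 1` and `y ≥ 2`, `‖Σ_{n ≤ y} μ(n) n^{-s} − ζ(s)⁻¹‖ ≤ C e^{-c√log y}`.
[cite: MontgomeryVaughan2007, §6.2] -/
theorem exists_norm_sum_moebius_div_rpow_sub_inv_zeta_le :
    ∃ c : ℝ, 0 < c ∧ ∃ C : ℝ, ∀ s : ℝ, 1 < s → ∀ y : ℝ, 2 ≤ y →
      ‖((∑ k ∈ Finset.Icc 1 ⌊y⌋₊, (μ k : ℝ) / (k : ℝ) ^ s : ℝ) : ℂ) - (riemannZeta (s : ℂ))⁻¹‖ ≤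
        C * Real.exp (-c * Real.sqrt (Real.log y)) := by
  obtain ⟨c, hc, C, hM⟩ := abs_sum_moebius_div_le_exp_neg_sqrt_log
  exact ⟨c, hc, 3 * C, fun s hs y hy ↦ norm_sum_moebius_div_rpow_sub_inv_zeta_le hc hM hs hy⟩

end Literature.NumberTheory.LFunctions

end
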